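import Summits.ABC.ABC.Theorems.DefiniteXiFreyModularitySketch
import Summits.ABC.ABC.Theorems.DefiniteXiFreyModularityStubFreySemistableDichotomy
import Summits.ABC.ABC.Theorems.DefiniteXiFreyModularityStubFreySwanOdd
import Summits.ABC.ABC.Theorems.DefiniteXiFreyModularityStubSwanEvenOfStableLine
import Summits.ABC.ABC.Theorems.DefiniteXiFreyModularityStubFreyFiveIrreducibleGlue
import HarnessLib

/-!
# Crux `FreyModularity` (stmt-ABC-11340), line `Sketch`, reshape 3 composed: Frey rigidity at `5`
# is a THEOREM, and `FreyModularity` rests on exactly the three modularity engines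

This file composes the four stubs of reshape 3 of the line `Sketch`
(`Summits/ABC/ABC/Cruxes/FreyModularity/Lines/Sketch.lean`), all landed:
`stub_freySemistableDichotomy` (p117468, Serre 1972 Prop. 21 ii) on the `16 ∣ B` Frey curves),
`stub_freySwanOdd` (the Swan conductor of `E[5]` above `2` is `1` or `3` on the additive normalised
Frey curves; Diamond–Kramer 1995 Lemma 2, from the tree's Galois-side Swan values of `E[3]` and the
`ℓ`-independence of the Swan conductor), `stub_swanEvenOfStableLine` (a `Γ_ℚ`-stable line makes it
even; Diamond–Kramer Lemma 3, from Hasse–Arf) and `stub_freyFiveIrreducibleGlue` (normalisation,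
twist invariance, the `j = 1728` exception and Kubert 1976 — `X₁(2,10)(ℚ)` = cusps, proved in the
tree).  Results:

* `hasIrreducibleModPGaloisRep_freyCurve_five`, `isIrreducible_freyCurve_five` — **Frey rigidity at
  `5`, unconditionally: for coprime `a, b` with `ab(a+b) ≠ 0`, `ρ̄_{E_(a,b),5}` is irreducible**
  (every framed model of `E_(a,b)[5]` is `FramedRep.IsIrreducible`).  This is the Frey-curve case of
  the hypothesis of Serre 1987 §4 / Darmon–Merel 1997 Thm. 2.2 at `p = 5`, previously available in
  the tree only from the Mazur–Kenku fact or from "`X₀(20)(ℚ)` = cusps".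
* `freyModularity_of_liftThree_liftFive_switch` — **the crux `FreyModularity` from the three
  remaining stubs of the line alone**: the semistable-at-`3` lifting statement (CDT 1999 Thm. 7.2.1
  restricted to `9 ∤ N`), the semistable-at-`5` lifting statement (Thm. 7.2.2 restricted to
  `25 ∤ N`) and the `3`–`5` switch.
* `freyModularity_of_CDT721_CDT722_switch` — the same on the tree's existing named facts
  `BCDT.CDT_theorem_7_2_1`, `BCDT.CDT_theorem_7_2_2`,
  `BCDT.exists_isTorsionGaloisRep_five_and_surjective_three` (the registered composition stub of the
  line; compare `freyModularity_of_CDT721_CDT722_switch_degreeNeTwenty`, whose fourth hypothesis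
  `X₀(20)` is now discharged).
-/

-- `Summit.<Summit>.<Problem>` is the mandated summit-side namespace (CONVENTIONS §2); for the
-- single-conjunct summit `ABC` the two coincide, so the duplicate `ABC.ABC` is deliberate.
set_option linter.dupNamespace false

noncomputable section

open scoped MatrixGroups NumberField

open Literature.NumberTheory.EllipticCurves
open Literature.NumberTheory.Automorphic
open Literature.NumberTheory.Automorphic.BCDT
open Literature.NumberTheory.GaloisRepresentations
open WeierstrassCurve

namespace Summit.ABC.ABC.Theorems

/-- **Frey rigidity at `5`: `E_(a,b)[5]` has no `Γ_ℚ`-stable subgroup other than `0` and `E[5]`**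
for coprime `a, b` with `ab(a+b) ≠ 0` — the four landed stubs of reshape 3 composed
(`stub_freyFiveIrreducibleGlue` fed with `stub_freySemistableDichotomy`, `stub_freySwanOdd`,
`stub_swanEvenOfStableLine`). [cite: DiamondKramer1995, Lemmas 1–3] [cite: Kubert1976, Ch. IV (X₁(2,10))] -/
theorem hasIrreducibleModPGaloisRep_freyCurve_five {a b : ℤ} (hab : IsCoprime a b)
    (h0 : a * b * (a + b) ≠ 0) : (freyCurve a b).HasIrreducibleModPGaloisRep 5 :=
  stub_freyFiveIrreducibleGlue
    (fun A B _ ↦ stub_freySemistableDichotomy A B)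
    (fun A B _ ↦ stub_freySwanOdd A B)
    (fun W _ ↦ stub_swanEvenOfStableLine W) a b hab h0

/-- **Frey rigidity at `5` for framed models: every framed model `ρ̄` of `E_(a,b)[5]` is
irreducible** (`a, b` coprime, `ab(a+b) ≠ 0`; `BCDT.isIrreducible_of_hasIrreducibleModPGaloisRep`).
[cite: DiamondKramer1995, Lemmas 1–3] -/
theorem isIrreducible_freyCurve_five :
    ∀ a b : ℤ, IsCoprime a b → a * b * (a + b) ≠ 0 →
      ∀ ρ : ModPGaloisRep ℚ (ZMod 5) 2, (freyCurve a b).IsTorsionGaloisRep 5 ρ →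
        FramedRep.IsIrreducible ρ := by
  intro a b hab h0 ρ hρ
  haveI := isElliptic_freyCurve h0
  exact isIrreducible_of_hasIrreducibleModPGaloisRep (hasIrreducibleModPGaloisRep_freyCurve_five hab h0) hρ

/-- **`FreyModularity` from the three remaining stubs of the line `Sketch` alone** — the
semistable-at-`3` lifting statement, the semistable-at-`5` lifting statement and the `3`–`5` switch
(`freyModularity_of_lifts` with the Frey rigidity `isIrreducible_freyCurve_five` supplied).
[cite: ConradDiamondTaylor1999, Thm. 7.1.2 (proof, p. 556)] -/
theorem freyModularity_of_liftThree_liftFive_switch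
    (hlift9 : ∀ (W : WeierstrassCurve ℚ) [W.IsElliptic] [NeZero (W.conductorNorm ℤ)]
      (ρ : ModPGaloisRep ℚ (ZMod 3) 2), W.IsTorsionGaloisRep 3 ρ →
      ρ.IsAbsIrreducibleOverSqrt (-3) → ¬ 9 ∣ W.conductorNorm ℤ → BCDT.IsModular W)
    (hlift25 : ∀ (W : WeierstrassCurve ℚ) [W.IsElliptic] [NeZero (W.conductorNorm ℤ)],
      ¬ 25 ∣ W.conductorNorm ℤ →
      ∀ (ρ : ModPGaloisRep ℚ (ZMod 5) 2), W.IsTorsionGaloisRep 5 ρ →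
      ρ.IsAbsIrreducibleOverSqrt 5 → ρ.IsModular → BCDT.IsModular W)
    (hsw : exists_isTorsionGaloisRep_five_and_surjective_three) :
    Summit.ABC.ABC.Theses.DefiniteXi.FreyModularity :=
  freyModularity_of_lifts hlift9 hlift25 hsw isIrreducible_freyCurve_five

/-- **Registered composition stub `freyModularity_of_CDT721_CDT722_switch` of the line `Sketch`:
`FreyModularity` on the trust base {CDT Thm. 7.2.1, CDT Thm. 7.2.2, the `3`–`5` switch}** — the
tree's named facts `BCDT.CDT_theorem_7_2_1` (`27 ∤ N` suffices for `9 ∤ N`), `BCDT.CDT_theorem_7_2_2`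
and `BCDT.exists_isTorsionGaloisRep_five_and_surjective_three`; the `X₀(20)` hypothesis of
`freyModularity_of_CDT721_CDT722_switch_degreeNeTwenty` is discharged by the Frey rigidity theorem
`isIrreducible_freyCurve_five`. [cite: ConradDiamondTaylor1999, Thm. 7.1.2 (proof, p. 556)] -/
theorem freyModularity_of_CDT721_CDT722_switch (h721 : CDT_theorem_7_2_1) (h722 : CDT_theorem_7_2_2)
    (hsw : exists_isTorsionGaloisRep_five_and_surjective_three) :
    Summit.ABC.ABC.Theses.DefiniteXi.FreyModularity :=
  freyModularity_of_lifts
    (fun W _ _ ρ hρ h3 h9 ↦ h721 W ρ hρ h3 fun h27 ↦ h9 ((show (9 : ℕ) ∣ 27 by norm_num).trans h27))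
    (fun W _ _ _ ρ hρ h5 hmod ↦ h722 W ρ hρ h5 hmod) hsw isIrreducible_freyCurve_five

end Summit.ABC.ABC.Theorems

end
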